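import Literature.NumberTheory.Automorphic.UnitaryGroupDirectSum                      -- ★ `UnitaryGroup.finSum` ∕ `reindexGL` ∕ `blockDiagGL`
import Literature.NumberTheory.Automorphic.UnitaryGroupIsotropicLineElements           -- ★ `hermForm_apply` ∕ `conj_hermForm` (via `UnitaryCayleyMomentMap`)
import Literature.NumberTheory.Automorphic.UnitaryGroupFormTransport                   -- ★ `formCongr`
import Literature.NumberTheory.Automorphic.GLnAdelicStructure                          -- ★ `glDiagonal`
import HarnessLib

/-!
# Crux `H413`, programme P2, N3 road, clause (a) — (BF) part 1: THE BLOCK FRAME over a commutative ring with involution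

Cell hodgecm-mathlib (D-0151), FLOOR 0, crux item H413 = stmt-HodgeConjecture-24833, programme P2; N3 road (#96 ★
`GelbartRogawski1991.thetaType_nonsplit_jacquetModule`, after ★ p836093 modulo its clause (a) alone), lead B-p18 (g29) dealing 2026-08-31T22:45:27Z (5)
«(BF) BLOCK-ADAPTED CONGRUENCE → A-p16 (g24)».  This is the ring-algebra half (sequel: `F0P2oBlockAdaptedCongruence`, the CM statement in ★
`cmDatumLocalCongr` ∕ `torusEntry` ∕ `BlockSum` currency).  THEOREMS ONLY (no `def`, no instance, no notation, no named fact, no `sorry`); no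
`Cruxes/…/Lines` import; kernel lane `--supports stmt-HodgeConjecture-24833 --as helper`.  HC_CM is proved only modulo the printed citations
(2 remaining named inputs hLiu418, h413) until rung 0 closes; this file is elementary hermitian linear algebra and asserts nothing printed.

* §0 `finSum_one_two_eq`, `diagonal_eq_finSum_one_two` (entries of a `1 ⊕ 2` block sum ★ `UnitaryGroup.finSum`; `Fin (1 + 2) = Fin 3` definitionally),
  `transpose_map_mul_mul_apply_eq_hermForm` (entries of `ᵗ(σA)·H·B` are pairings of columns, ★ `hermForm`).
* §1 **`exists_blockFrame`** — over ANY commutative ring `S` with involution `σ`, for `a : Fin 3 → S` fixed by `σ` with `a₀` a unit and a hyperbolic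
  pair `(x, xs)` of the plane `diag(a₁, a₂)` scaled to `h₂(x, xs) = a₀` (`h₂(x,x) = h₂(xs,xs) = 0`): the plane frame `X = (x ∣ xs) ∈ GL₂(S)`
  (`ᵗ(σX) diag(a₁,a₂) X = a₀ • Φ₂`), the block-adapted frame `T₀ = (0,x) ∣ (1,0,0) ∣ (0,xs) = (1 ⊕ X) · P₀₁ ∈ GL₃(S)` (`P₀₁` the swap of the
  first two basis vectors; `ᵗ(σT₀) diag(a) T₀ = a₀ • Φ₃`) and the conjugation laws **`T₀ · diag(1, β, 1) · T₀⁻¹ = β ⊕ 1₂`**,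
  **`T₀ · diag(γ, 1, δ) · T₀⁻¹ = 1 ⊕ (X · diag(γ, δ) · X⁻¹)`** in `GL₃(S)` (★ `UnitaryGroup.reindexGL finSumFinEquiv (UnitaryGroup.blockDiagGL …)`,
  the matrix shape of ★ `BlockSum.inlLocal` ∕ `inrLocal`).

[Dieudonne1971GroupesClassiques, Chap. II §§4–5 (Witt, hyperbolic planes); Kudla1984, §1 (see-saw `U(V₁) × U(V₂) ⊂ U(V₁ ⊥ V₂)`);
PlatonovRapinchuk1994, §2.3 (form congruences).]
-/

set_option autoImplicit false
-- the mandated namespace has the single-problem summit's repeated segment (`HodgeConjecture.HodgeConjecture`)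
set_option linter.dupNamespace false

noncomputable section

open scoped Matrix MatrixGroups
open _root_.Matrix
open Literature.NumberTheory.Automorphic Literature.NumberTheory.Automorphic.UnitaryGroup

namespace Summit.HodgeConjecture.HodgeConjecture.Cruxes.H413.F0P2oBlockFrame


/-! ## §0 Block bookkeeping on `Fin 3 = Fin (1 + 2)` -/

section Generic

variable {S : Type*} [CommRing S]

/-- `finSumFinEquiv⁻¹` on `Fin (1 + 2)`: `0 ↦ inl 0`, `1 ↦ inr 0`, `2 ↦ inr 1`. [folklore] -/
theorem finSumFinEquiv_symm_one_two :
    (finSumFinEquiv.symm (0 : Fin (1 + 2)) : Fin 1 ⊕ Fin 2) = Sum.inl 0 ∧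
      (finSumFinEquiv.symm (1 : Fin (1 + 2)) : Fin 1 ⊕ Fin 2) = Sum.inr 0 ∧
        (finSumFinEquiv.symm (2 : Fin (1 + 2)) : Fin 1 ⊕ Fin 2) = Sum.inr 1 :=
  ⟨finSumFinEquiv_symm_apply_castAdd (0 : Fin 1), finSumFinEquiv_symm_apply_natAdd (0 : Fin 2),
    finSumFinEquiv_symm_apply_natAdd (1 : Fin 2)⟩

/-- **entries of a `1 ⊕ 2` block sum**: `A ⊕ᶠ B = !![A₀₀, 0, 0; 0, B₀₀, B₀₁; 0, B₁₀, B₁₁]`. [cite: Kudla1984, §1] -/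
theorem finSum_one_two_eq (A : Matrix (Fin 1) (Fin 1) S) (B : Matrix (Fin 2) (Fin 2) S) :
    UnitaryGroup.finSum 1 2 A B = !![A 0 0, 0, 0; 0, B 0 0, B 0 1; 0, B 1 0, B 1 1] := by
  obtain ⟨h0, h1, h2⟩ := finSumFinEquiv_symm_one_two
  ext i j
  fin_cases i <;> fin_cases j <;>
    simp [UnitaryGroup.finSum, Matrix.reindex_apply, Matrix.submatrix_apply, h0, h1, h2]

/-- `diag(d₀, d₁, d₂) = diag(d₀) ⊕ᶠ diag(d₁, d₂)`. [cite: Kudla1984, §1] -/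
theorem diagonal_eq_finSum_one_two (d : Fin 3 → S) :
    Matrix.diagonal d = UnitaryGroup.finSum 1 2 (Matrix.diagonal fun _ : Fin 1 => d 0) (Matrix.diagonal fun k : Fin 2 => d k.succ) := by
  rw [finSum_one_two_eq]
  ext i j
  fin_cases i <;> fin_cases j <;> simp [Matrix.diagonal]

variable (σ : S →+* S) {m n p : Type*} [Fintype n]

/-- **entries of `ᵗ(σA) · H · B` are the pairings of the columns**: `(ᵗ(σA) H B)ᵢⱼ = h(A eᵢ, B eⱼ)`.
[cite: Dieudonne1971GroupesClassiques, Chap. II §5] -/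
theorem transpose_map_mul_mul_apply_eq_hermForm (A : Matrix n m S) (H : Matrix n n S) (B : Matrix n p S) (i : m) (j : p) :
    ((A.map σ)ᵀ * H * B) i j = hermForm σ H (fun k => A k i) (fun k => B k j) := by
  rw [hermForm_apply, Matrix.mul_assoc]
  simp only [Matrix.mul_apply, dotProduct, Matrix.mulVec, Matrix.transpose_apply, Matrix.map_apply, Function.comp_apply]

/-! ## §1 The block frame over a commutative ring with involution -/

set_option maxHeartbeats 4000000 in
/-- **THE BLOCK FRAME** over any commutative ring `S` with an involution `σ`: for `a : Fin 3 → S` fixed by `σ` with `a₀` a unit and a hyperbolic pair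
`(x, xs)` of the plane `diag(a₁, a₂)` scaled to `h₂(x, xs) = a₀`, the plane frame `X = (x ∣ xs)` and the block-adapted frame
`T₀ = (0,x) ∣ (1,0,0) ∣ (0,xs) = (1 ⊕ X) · P₀₁` with `ᵗ(σX) diag(a₁,a₂) X = a₀ • Φ₂`, `ᵗ(σT₀) diag(a) T₀ = a₀ • Φ₃`,
`T₀ · diag(1, β, 1) · T₀⁻¹ = β ⊕ 1₂` and `T₀ · diag(γ, 1, δ) · T₀⁻¹ = 1 ⊕ (X · diag(γ, δ) · X⁻¹)`.
[cite: Dieudonne1971GroupesClassiques, Chap. II §5] [cite: Kudla1984, §1] -/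
theorem exists_blockFrame (hσσ : ∀ z, σ (σ z) = z) (a : Fin 3 → S) (ha : ∀ i, σ (a i) = a i) (ha0 : IsUnit (a 0))
    (x xs : Fin 2 → S)
    (hxx : hermForm σ (Matrix.diagonal fun k : Fin 2 => a k.succ) x x = 0)
    (hss : hermForm σ (Matrix.diagonal fun k : Fin 2 => a k.succ) xs xs = 0)
    (hxs : hermForm σ (Matrix.diagonal fun k : Fin 2 => a k.succ) x xs = a 0) :
    ∃ (X : GL (Fin 2) S) (T₀ : GL (Fin 3) S),
      (X : Matrix (Fin 2) (Fin 2) S) = !![x 0, xs 0; x 1, xs 1] ∧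
      (T₀ : Matrix (Fin 3) (Fin 3) S) = !![0, 1, 0; x 0, 0, xs 0; x 1, 0, xs 1] ∧
      formCongr σ X (Matrix.diagonal fun k : Fin 2 => a k.succ) = a 0 • !![(0 : S), 1; 1, 0] ∧
      formCongr σ T₀ (Matrix.diagonal a) = a 0 • !![(0 : S), 0, 1; 0, 1, 0; 1, 0, 0] ∧
      (∀ d : Fin 3 → Sˣ, d 0 = 1 → d 2 = 1 →
        T₀ * glDiagonal 3 S d * T₀⁻¹ =
          UnitaryGroup.reindexGL finSumFinEquiv (UnitaryGroup.blockDiagGL (glDiagonal 1 S (fun _ : Fin 1 => d 1), (1 : GL (Fin 2) S)))) ∧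
      (∀ (d : Fin 3 → Sˣ) (e : Fin 2 → Sˣ), d 1 = 1 → e 0 = d 0 → e 1 = d 2 →
        T₀ * glDiagonal 3 S d * T₀⁻¹ =
          UnitaryGroup.reindexGL finSumFinEquiv (UnitaryGroup.blockDiagGL ((1 : GL (Fin 1) S), X * glDiagonal 2 S e * X⁻¹))) := by
  classical
  set H₂ : Matrix (Fin 2) (Fin 2) S := Matrix.diagonal fun k : Fin 2 => a k.succ with hH₂
  -- `H₂` is hermitian, so `h₂(xs, x) = a₀` too
  have hH₂h : (H₂.map σ)ᵀ = H₂ := by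
    rw [hH₂, Matrix.diagonal_map (map_zero σ), Matrix.diagonal_transpose]
    congr 1; funext k; exact ha k.succ
  have hsx : hermForm σ H₂ xs x = a 0 := by rw [← conj_hermForm σ H₂ hσσ hH₂h x xs, hxs, ha 0]
  -- the pairings on the diagonal plane and space, explicitly
  have hpair : ∀ u w : Fin 2 → S, hermForm σ H₂ u w = σ (u 0) * (a 1 * w 0) + σ (u 1) * (a 2 * w 1) := by
    intro u w
    simp only [hH₂, hermForm_apply, dotProduct, Fin.sum_univ_two, Matrix.mulVec_diagonal, Function.comp_apply]
    rfl
  have hpair3 : ∀ u w : Fin 3 → S, hermForm σ (Matrix.diagonal a) u w =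
      σ (u 0) * (a 0 * w 0) + σ (u 1) * (a 1 * w 1) + σ (u 2) * (a 2 * w 2) := by
    intro u w
    simp only [hermForm_apply, dotProduct, Fin.sum_univ_three, Matrix.mulVec_diagonal, Function.comp_apply]
  have hxx' := hxx; have hss' := hss; have hxs' := hxs; have hsx' := hsx
  rw [hpair] at hxx' hss' hxs' hsx'
  have hσ0 : σ 0 = 0 := map_zero σ
  have hσ1 : σ 1 = 1 := map_one σ
  /- ### the plane frame `X = (x ∣ xs)` -/
  set Xm : Matrix (Fin 2) (Fin 2) S := !![x 0, xs 0; x 1, xs 1] with hXm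
  have hraw : (Xm.map σ)ᵀ * H₂ * Xm = a 0 • !![(0 : S), 1; 1, 0] := by
    ext i j
    rw [transpose_map_mul_mul_apply_eq_hermForm, hpair, hXm]
    fin_cases i <;> fin_cases j
    · simp; linear_combination hxx'
    · simp; linear_combination hxs'
    · simp; linear_combination hsx'
    · simp; linear_combination hss'
  -- `det X` is a unit: `σ(det X) · det H₂ · det X = det (a₀ • Φ₂) = −a₀²`
  have hdetu : IsUnit Xm.det := by
    have hd := congrArg Matrix.det hraw
    rw [Matrix.det_mul, Matrix.det_mul, Matrix.det_transpose] at hd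
    have hr : IsUnit (a 0 • !![(0 : S), 1; 1, 0]).det := by
      have h1 : (a 0 • !![(0 : S), 1; 1, 0]).det = -(a 0 * a 0) := by
        rw [Matrix.det_fin_two]; simp
      rw [h1, IsUnit.neg_iff]
      exact ha0.mul ha0
    rw [← hd] at hr
    exact isUnit_of_mul_isUnit_right hr
  obtain ⟨X, hXcoe⟩ : ∃ X : GL (Fin 2) S, (X : Matrix (Fin 2) (Fin 2) S) = Xm :=
    ⟨((Matrix.isUnit_iff_isUnit_det Xm).2 hdetu).unit, IsUnit.unit_spec _⟩
  have hX : formCongr σ X H₂ = a 0 • !![(0 : S), 1; 1, 0] := by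
    change ((X : Matrix (Fin 2) (Fin 2) S).map σ)ᵀ * H₂ * (X : Matrix (Fin 2) (Fin 2) S) = _
    rw [hXcoe]; exact hraw
  /- ### the swap of the first two basis vectors and the frame `T₀ = (1 ⊕ X) · P₀₁` -/
  set P : Matrix (Fin 3) (Fin 3) S := !![0, 1, 0; 1, 0, 0; 0, 0, 1] with hP
  have hPP : P * P = 1 := by
    rw [hP, Matrix.one_fin_three]; simp
  set P01 : GL (Fin 3) S := ⟨P, P, hPP, hPP⟩ with hP01
  set RB : GL (Fin 3) S := UnitaryGroup.reindexGL finSumFinEquiv (UnitaryGroup.blockDiagGL ((1 : GL (Fin 1) S), X)) with hRB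
  have hRBcoe : (RB : Matrix (Fin 3) (Fin 3) S) = !![1, 0, 0; 0, x 0, xs 0; 0, x 1, xs 1] := by
    have h1 : (RB : Matrix (Fin 3) (Fin 3) S) = UnitaryGroup.finSum 1 2 (1 : Matrix (Fin 1) (Fin 1) S) Xm := by
      rw [hRB, UnitaryGroup.coe_reindexGL, UnitaryGroup.coe_blockDiagGL, Units.val_one, hXcoe]; rfl
    rw [h1, finSum_one_two_eq, hXm]
    ext i j; fin_cases i <;> fin_cases j <;> simp
  have hT₀coe : ((RB * P01 : GL (Fin 3) S) : Matrix (Fin 3) (Fin 3) S) = !![0, 1, 0; x 0, 0, xs 0; x 1, 0, xs 1] := by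
    rw [Units.val_mul, hRBcoe]
    change !![1, 0, 0; 0, x 0, xs 0; 0, x 1, xs 1] * P = _
    rw [hP]; ext i j; fin_cases i <;> fin_cases j <;> simp [Matrix.mul_apply, Fin.sum_univ_three]
  have h₀ : formCongr σ (RB * P01) (Matrix.diagonal a) = a 0 • !![(0 : S), 0, 1; 0, 1, 0; 1, 0, 0] := by
    ext i j
    rw [formCongr, transpose_map_mul_mul_apply_eq_hermForm, hT₀coe, hpair3]
    fin_cases i <;> fin_cases j
    · simp [hσ0]; linear_combination hxx'
    · simp [hσ0]
    · simp [hσ0]; linear_combination hxs'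
    · simp [hσ0, hσ1]
    · simp [hσ0, hσ1]
    · simp [hσ0, hσ1]
    · simp [hσ0]; linear_combination hsx'
    · simp [hσ0]
    · simp [hσ0]; linear_combination hss'
  /- ### diagonal bookkeeping -/
  have hdiag3 : ∀ f : Fin 3 → S, Matrix.diagonal f = !![f 0, 0, 0; 0, f 1, 0; 0, 0, f 2] := fun f => by
    ext i j; fin_cases i <;> fin_cases j <;> simp [Matrix.diagonal]
  -- conjugating a diagonal by the swap permutes its first two entries
  have hPdiag : ∀ d : Fin 3 → Sˣ, P01 * glDiagonal 3 S d * P01⁻¹ = glDiagonal 3 S (d ∘ ⇑(Equiv.swap (0 : Fin 3) 1)) := by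
    intro d
    apply Units.ext
    rw [Units.val_mul, Units.val_mul, coe_glDiagonal, coe_glDiagonal]
    change P * (Matrix.diagonal fun k => (d k : S)) * P = Matrix.diagonal fun k => ((d ∘ ⇑(Equiv.swap (0 : Fin 3) 1)) k : S)
    rw [hP, hdiag3, hdiag3]
    simp [Equiv.swap_apply_of_ne_of_ne]
  -- a diagonal is the block sum of its line and plane parts
  have hDiagBlock : ∀ d : Fin 3 → Sˣ, glDiagonal 3 S d =
      UnitaryGroup.reindexGL finSumFinEquiv
        (UnitaryGroup.blockDiagGL (glDiagonal 1 S (fun _ : Fin 1 => d 0), glDiagonal 2 S (fun k : Fin 2 => d k.succ))) := by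
    intro d
    apply Units.ext
    rw [coe_glDiagonal, UnitaryGroup.coe_reindexGL, UnitaryGroup.coe_blockDiagGL, coe_glDiagonal, coe_glDiagonal]
    exact diagonal_eq_finSum_one_two _
  -- conjugation of a block sum by `1 ⊕ X`
  have hconj : ∀ (g₁ : GL (Fin 1) S) (g₂ : GL (Fin 2) S),
      RB * UnitaryGroup.reindexGL finSumFinEquiv (UnitaryGroup.blockDiagGL (g₁, g₂)) * RB⁻¹ =
        UnitaryGroup.reindexGL finSumFinEquiv (UnitaryGroup.blockDiagGL (g₁, X * g₂ * X⁻¹)) := by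
    intro g₁ g₂
    rw [hRB, ← map_inv, ← map_inv, ← map_mul, ← map_mul, ← map_mul, ← map_mul, Prod.inv_mk, Prod.mk_mul_mk, Prod.mk_mul_mk,
      one_mul, inv_one, mul_one]
  have hassoc : ∀ D : GL (Fin 3) S, RB * P01 * D * (RB * P01)⁻¹ = RB * (P01 * D * P01⁻¹) * RB⁻¹ := by
    intro D; simp only [_root_.mul_inv_rev, mul_assoc]
  refine ⟨X, RB * P01, hXcoe, hT₀coe, hX, h₀, ?_, ?_⟩
  · /- `T₀ · diag(1, β, 1) · T₀⁻¹ = β ⊕ 1₂` -/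
    intro d hd0 hd2
    have hswap : glDiagonal 3 S (d ∘ ⇑(Equiv.swap (0 : Fin 3) 1)) =
        UnitaryGroup.reindexGL finSumFinEquiv (UnitaryGroup.blockDiagGL (glDiagonal 1 S (fun _ : Fin 1 => d 1), (1 : GL (Fin 2) S))) := by
      rw [hDiagBlock]
      have h1 : (fun _ : Fin 1 => (d ∘ ⇑(Equiv.swap (0 : Fin 3) 1)) 0) = fun _ : Fin 1 => d 1 := by
        funext; simp
      have h2 : (fun k : Fin 2 => (d ∘ ⇑(Equiv.swap (0 : Fin 3) 1)) k.succ) = 1 := by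
        funext k; fin_cases k
        · simp [hd0]
        · simp [Equiv.swap_apply_of_ne_of_ne, hd2]
      rw [h1, h2, map_one]
    rw [hassoc, hPdiag, hswap, hconj, mul_one, mul_inv_cancel]
  · /- `T₀ · diag(γ, 1, δ) · T₀⁻¹ = 1 ⊕ (X · diag(γ, δ) · X⁻¹)` -/
    intro d e hd1 he0 he1
    have hswap : glDiagonal 3 S (d ∘ ⇑(Equiv.swap (0 : Fin 3) 1)) =
        UnitaryGroup.reindexGL finSumFinEquiv (UnitaryGroup.blockDiagGL ((1 : GL (Fin 1) S), glDiagonal 2 S e)) := by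
      rw [hDiagBlock]
      have h1 : (fun _ : Fin 1 => (d ∘ ⇑(Equiv.swap (0 : Fin 3) 1)) 0) = 1 := by
        funext; simp [hd1]
      have h2 : (fun k : Fin 2 => (d ∘ ⇑(Equiv.swap (0 : Fin 3) 1)) k.succ) = e := by
        funext k; fin_cases k
        · simp [he0]
        · simp [Equiv.swap_apply_of_ne_of_ne, he1]
      rw [h1, h2, map_one]
    rw [hassoc, hPdiag, hswap, hconj]

end Generic

end Summit.HodgeConjecture.HodgeConjecture.Cruxes.H413.F0P2oBlockFrame

end
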